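import Mathlib
import Summits.ValiantsHypothesis.ValiantsHypothesis.Theorems.GirthSidonMomentCurveElusiveCoveringGirth

/-!
# Route GirthSidon — crux `PolySwallowForcesShortRelation` (stmt-ValiantsHypothesis-6537), line
`two_ended_honesty`: CROSS-HONEST ABSORPTION and the TOTALLY-BORN residual of `stub_doublyBornTargets`

Polynomial sources `y_j ∈ ℂ[x]` carry two valuations seeing the monomial targets `x^{d_i} = Γ_i(y)`:
the order at `0` (`natTrailingDegree`) and the order at `∞` (`natDegree`).  With
`W = span_ℂ(1, y_1, …, y_s)`, `O₀ = ord₀(W ∖ 0)`, `O_∞ = deg(W ∖ 0)` the line `two_ended_honesty`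
splits the targets into the HONEST ones (`d_i ∈ O₀ + O₀` or `d_i ∈ O_∞ + O_∞`, registered stub
`stub_honestTargets`) and the DOUBLY-BORN ones (registered stub `stub_doublyBornTargets`, the open
residual).  This file records that the split leaks in the prover's favour: a doubly-born target may still
be CROSS-HONEST, `d_i ∈ O₀ + O_∞` (the order of one factor plus the degree of another), and then it is
covered by the same sumset `U + U`, `U = O₀ ∪ O_∞`, `|U| ≤ 2(s+1)`, that the girth engine
`Theorems.stub_coveringGirth` consumes.  Examples: the line card's flagship
`x⁹ ∈ ⟨1, x², x⁴, x⁸, x⁶ − 2x³⟩²` is `3 + 6 ∈ O₀ + O_∞`; every `2 × 2` gadget of binomial units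
`x^{o}(1 + c x^{p})` outputs `w + p ∈ O₀ + O_∞` or an `∞`-honest exponent.

Contents (all sorry-free, standard axioms):
* `linearIndependent_of_triangular`, `card_le_of_natTrailingDegree`, `card_le_of_natDegree` — the two
  polynomial echelon counts: nonzero elements of `span F` with pairwise distinct orders (degrees) are
  linearly independent, so at most `|F|` orders (degrees) occur;
* `relation_of_orderDegreeCover` — COVER FORM of the honest half with the cross case included: if every
  `d_i` is `ord f + ord g`, `ord f + deg g` or `deg f + deg g` for nonzero `f, g ∈ W`, and
  `s^10 ≤ C·m^9`, then for `m ≥ m₀(C)` a relation of length `≤ 30` exists (non-injective `d`: the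
  relation `{i} ≠ {j}`; injective `d`: `stub_coveringGirth` with `|U|^20 ≤ (2s+2)^20 ≤ m^19`);
* `stub_doublyBornTargets_of_totallyBorn` — the registered stub `stub_doublyBornTargets` (its
  `HonestAtZero` / `HonestAtInfty` / `sourceSpan` unfolded, constant `512`) FOLLOWS from the strictly
  smaller TOTALLY-BORN residual: the same conclusion for targets with
  `d_i ∉ (O₀ ∪ O_∞) + (O₀ ∪ O_∞)` under `s^10 ≤ 2^18·m^9` (majority split: the larger of the two classes
  has `m' ≥ m/2` elements, restriction along `Finset.orderEmbOfFin`).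

No claim is made on the totally-born residual itself (conjecture-grade; first mechanism on record that
produces totally-born monomials: an ABSORBED TRINOMIAL `x^a + x^b + x^c` times a monomial source `x^t`
whose outer products `x^{a+t}`, `x^{c+t}` are toric coincidences, exposing `x^{b+t}` — girth-capped like
the toric case).  VP ≠ VNP is not moved by this file.
[folklore; BondySimonovits1974 Thm. 1 enters only through the imported girth engine]
-/

set_option linter.dupNamespace false

namespace Summit.ValiantsHypothesis.ValiantsHypothesis.Theorems

open Polynomial

namespace PolySwallowTotallyBorn

/-- **Unitriangular certificate ⇒ linear independence.**  If `deg` ranks the family injectively and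
linear functionals `φ i` satisfy `φ i (v i) ≠ 0` and `φ i (v j) = 0` whenever `deg j < deg i`, then `v`
is linearly independent (apply `φ a` to a dependency at the index `a` of maximal rank). [folklore] -/
theorem linearIndependent_of_triangular {K M ι : Type*} [Field K] [AddCommGroup M] [Module K M]
    {β : Type*} [LinearOrder β] (v : ι → M) (φ : ι → M →ₗ[K] K) (deg : ι → β)
    (hinj : Function.Injective deg) (hdiag : ∀ i, φ i (v i) ≠ 0)
    (hlow : ∀ i j, deg j < deg i → φ i (v j) = 0) : LinearIndependent K v := by
  classical
  rw [linearIndependent_iff']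
  intro s
  induction s using Finset.induction_on_max_value deg with
  | empty => intro g _ i hi; exact absurd hi (Finset.notMem_empty i)
  | insert a s has hmax ih =>
    intro g hg i hi
    rw [Finset.sum_insert has] at hg
    have hga : g a = 0 := by
      have h1 := congrArg (φ a) hg
      rw [map_add, map_sum, map_zero, map_smul] at h1
      have h2 : ∑ x ∈ s, φ a (g x • v x) = 0 := Finset.sum_eq_zero fun x hx => by
        have hne : x ≠ a := fun h => has (h ▸ hx)
        have hlt : deg x < deg a := lt_of_le_of_ne (hmax x hx) fun h => hne (hinj h)
        rw [map_smul, hlow a x hlt, smul_zero]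
      rw [h2, add_zero, smul_eq_mul] at h1
      exact (mul_eq_zero.mp h1).resolve_right (hdiag a)
    rw [hga, zero_smul, zero_add] at hg
    rcases Finset.mem_insert.mp hi with rfl | hi'
    · exact hga
    · exact ih g hg i hi'

/-- **Echelon count at `0`.**  If every `n ∈ T` is the order (`natTrailingDegree`) of a nonzero element of
`span F`, then `|T| ≤ |F|`: elements with distinct orders are linearly independent (coefficient
extraction at the trailing exponent), and an independent family inside `span F` has at most `|F|`
members. [folklore] -/
theorem card_le_of_natTrailingDegree {K : Type*} [Field K] (F : Finset K[X]) (T : Finset ℕ)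
    (hT : ∀ n ∈ T, ∃ f ∈ Submodule.span K (F : Set K[X]), f ≠ 0 ∧ f.natTrailingDegree = n) :
    T.card ≤ F.card := by
  classical
  choose f hf hf0 hfn using hT
  let v : T → K[X] := fun n => f n.1 n.2
  have hli : LinearIndependent K v := by
    refine linearIndependent_of_triangular v (fun n => Polynomial.lcoeff K (v n).natTrailingDegree)
      (fun n => OrderDual.toDual (v n).natTrailingDegree) ?_ ?_ ?_
    · intro a b hab
      apply Subtype.ext
      have h : (v a).natTrailingDegree = (v b).natTrailingDegree := by simpa using hab
      rw [hfn a.1 a.2, hfn b.1 b.2] at h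
      exact h
    · intro n
      rw [Polynomial.lcoeff_apply]
      exact Polynomial.trailingCoeff_nonzero_iff_nonzero.mpr (hf0 n.1 n.2)
    · intro a b hab
      rw [Polynomial.lcoeff_apply]
      exact Polynomial.coeff_eq_zero_of_lt_natTrailingDegree (OrderDual.toDual_lt_toDual.mp hab)
  have hrange : Set.range v ≤ Submodule.span K (F : Set K[X]) := by
    rintro _ ⟨n, rfl⟩
    exact hf n.1 n.2
  have h := linearIndependent_le_span_aux' v hli (F : Set K[X]) hrange
  simpa only [Finset.coe_sort_coe, Fintype.card_coe] using h

/-- **Echelon count at `∞`.**  If every `n ∈ T` is the degree of a nonzero element of `span F`, then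
`|T| ≤ |F|` (leading-coefficient extraction). [folklore] -/
theorem card_le_of_natDegree {K : Type*} [Field K] (F : Finset K[X]) (T : Finset ℕ)
    (hT : ∀ n ∈ T, ∃ f ∈ Submodule.span K (F : Set K[X]), f ≠ 0 ∧ f.natDegree = n) :
    T.card ≤ F.card := by
  classical
  choose f hf hf0 hfn using hT
  let v : T → K[X] := fun n => f n.1 n.2
  have hli : LinearIndependent K v := by
    refine linearIndependent_of_triangular v (fun n => Polynomial.lcoeff K (v n).natDegree)
      (fun n => (v n).natDegree) ?_ ?_ ?_
    · intro a b hab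
      apply Subtype.ext
      have h : (v a).natDegree = (v b).natDegree := by simpa using hab
      rw [hfn a.1 a.2, hfn b.1 b.2] at h
      exact h
    · intro n
      rw [Polynomial.lcoeff_apply]
      exact Polynomial.leadingCoeff_ne_zero.mpr (hf0 n.1 n.2)
    · intro a b hab
      rw [Polynomial.lcoeff_apply]
      exact Polynomial.coeff_eq_zero_of_natDegree_lt hab
  have hrange : Set.range v ≤ Submodule.span K (F : Set K[X]) := by
    rintro _ ⟨n, rfl⟩
    exact hf n.1 n.2
  have h := linearIndependent_le_span_aux' v hli (F : Set K[X]) hrange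
  simpa only [Finset.coe_sort_coe, Fintype.card_coe] using h

/-- The source set `{1, y_1, …, y_s}` as a finset has at most `s + 1` elements and spans
`span_ℂ(insert 1 (range y))`. [folklore] -/
theorem sourceFinset_card_le {s : ℕ} (y : Fin s → ℂ[X]) :
    (insert (1 : ℂ[X]) (Finset.univ.image y)).card ≤ s + 1 ∧
      ((insert (1 : ℂ[X]) (Finset.univ.image y) : Finset ℂ[X]) : Set ℂ[X]) =
        insert 1 (Set.range y) := by
  classical
  refine ⟨?_, ?_⟩
  · calc (insert (1 : ℂ[X]) (Finset.univ.image y)).card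
        ≤ (Finset.univ.image y).card + 1 := Finset.card_insert_le _ _
      _ ≤ s + 1 := by
          have := Finset.card_image_le (s := (Finset.univ : Finset (Fin s))) (f := y)
          simp only [Finset.card_univ, Fintype.card_fin] at this
          omega
  · rw [Finset.coe_insert, Finset.coe_image, Finset.coe_univ, Set.image_univ]

/-- A non-injective exponent vector has the length-one relation `{i} ≠ {j}`. [folklore] -/
theorem relation_of_not_injective {m : ℕ} (d : Fin m → ℕ) (h : ¬ Function.Injective d) :
    ∃ S T : Multiset (Fin m), S ≠ T ∧ Multiset.card S ≤ 30 ∧ Multiset.card T ≤ 30 ∧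
      (S.map d).sum = (T.map d).sum := by
  obtain ⟨i, j, hij, hne⟩ : ∃ i j, d i = d j ∧ i ≠ j := by
    simpa [Function.Injective] using h
  exact ⟨{i}, {j}, by simpa using hne, by simp, by simp, by simpa using hij⟩

/-- Numeric side condition: from `s^10 ≤ C m^9` and `m ≥ 2^40 (C+1)^2` we get `(2s+2)^20 ≤ m^19`.
[folklore] -/
theorem pow_twenty_le {s m C : ℕ} (hs : s ^ 10 ≤ C * m ^ 9) (hm : 2 ^ 40 * (C + 1) ^ 2 ≤ m) :
    (2 * s + 2) ^ 20 ≤ m ^ 19 := by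
  have h0 : 0 < 2 ^ 40 * (C + 1) ^ 2 := by positivity
  have hm1 : 1 ≤ m := le_trans (Nat.succ_le_of_lt h0) hm
  have h1 : (s + 1) ^ 10 ≤ 2 ^ 10 * (s ^ 10 + 1) := by
    rcases Nat.eq_zero_or_pos s with rfl | hs0
    · norm_num
    · calc (s + 1) ^ 10 ≤ (2 * s) ^ 10 := Nat.pow_le_pow_left (by omega) 10
        _ = 2 ^ 10 * s ^ 10 := by ring
        _ ≤ 2 ^ 10 * (s ^ 10 + 1) := by omega
  have h2 : s ^ 10 + 1 ≤ (C + 1) * m ^ 9 := by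
    have : 1 ≤ m ^ 9 := Nat.one_le_pow _ _ hm1
    nlinarith
  calc (2 * s + 2) ^ 20 = 2 ^ 20 * ((s + 1) ^ 10) ^ 2 := by ring
    _ ≤ 2 ^ 20 * (2 ^ 10 * (s ^ 10 + 1)) ^ 2 := by gcongr
    _ ≤ 2 ^ 20 * (2 ^ 10 * ((C + 1) * m ^ 9)) ^ 2 := by gcongr
    _ = (2 ^ 40 * (C + 1) ^ 2) * m ^ 18 := by ring
    _ ≤ m * m ^ 18 := by gcongr
    _ = m ^ 19 := by ring

/-- **Cover form of the honest half, cross case included.**  For every constant `C` there is `m₀` such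
that for `m ≥ m₀`, `s^10 ≤ C·m^9` and polynomial sources `y : Fin s → ℂ[x]` with
`W = span_ℂ(1, y)`: if every exponent `d_i` is `ord f + ord g`, `ord f + deg g` or `deg f + deg g` for
some nonzero `f, g ∈ W` (honest at `0`, CROSS-honest, or honest at `∞`), then two distinct multisets of
`≤ 30` indices have equal `d`-sums.  Proof: non-injective `d` gives `{i} ≠ {j}`; otherwise the chosen
orders and degrees form `U ⊂ ℤ` with `|U| ≤ 2(s+1)` (two echelon counts), `d_i ∈ U + U`,
`|U|^20 ≤ (2s+2)^20 ≤ m^19`, and `Theorems.stub_coveringGirth` applies.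
[cite: BondySimonovits1974, Thm. 1 — via the imported girth engine] -/
theorem relation_of_orderDegreeCover (C : ℕ) :
    ∃ m₀ : ℕ, ∀ m ≥ m₀, ∀ (d : Fin m → ℕ) (s : ℕ), s ^ 10 ≤ C * m ^ 9 →
      ∀ (y : Fin s → Polynomial ℂ),
        (∀ i, ∃ f ∈ Submodule.span ℂ (insert 1 (Set.range y)),
          ∃ g ∈ Submodule.span ℂ (insert 1 (Set.range y)), f ≠ 0 ∧ g ≠ 0 ∧
            (d i = f.natTrailingDegree + g.natTrailingDegree ∨
             d i = f.natTrailingDegree + g.natDegree ∨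
             d i = f.natDegree + g.natDegree)) →
        ∃ S T : Multiset (Fin m), S ≠ T ∧ Multiset.card S ≤ 30 ∧ Multiset.card T ≤ 30 ∧
          (S.map d).sum = (T.map d).sum := by
  classical
  obtain ⟨mG, hG⟩ := stub_coveringGirth
  refine ⟨max mG (2 ^ 40 * (C + 1) ^ 2), fun m hm d s hs y hcov => ?_⟩
  have hmG : mG ≤ m := le_trans (le_max_left _ _) hm
  have hmC : 2 ^ 40 * (C + 1) ^ 2 ≤ m := le_trans (le_max_right _ _) hm
  by_cases hinj : Function.Injective d
  swap
  · exact relation_of_not_injective d hinj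
  choose f hf g hg hf0 hg0 hor using hcov
  -- the source finset
  let F : Finset ℂ[X] := insert (1 : ℂ[X]) (Finset.univ.image y)
  obtain ⟨hFcard, hFcoe⟩ := sourceFinset_card_le y
  have hfF : ∀ i, f i ∈ Submodule.span ℂ (F : Set ℂ[X]) := fun i => by rw [hFcoe]; exact hf i
  have hgF : ∀ i, g i ∈ Submodule.span ℂ (F : Set ℂ[X]) := fun i => by rw [hFcoe]; exact hg i
  -- which end each factor contributes
  let a : Fin m → ℕ := fun i =>
    if d i = (f i).natTrailingDegree + (g i).natTrailingDegree ∨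
        d i = (f i).natTrailingDegree + (g i).natDegree
    then (f i).natTrailingDegree else (f i).natDegree
  let b : Fin m → ℕ := fun i =>
    if d i = (f i).natTrailingDegree + (g i).natTrailingDegree
    then (g i).natTrailingDegree else (g i).natDegree
  have hab : ∀ i, d i = a i + b i := by
    intro i
    simp only [a, b]
    rcases hor i with h1 | h2 | h3
    · rw [if_pos (Or.inl h1), if_pos h1]; exact h1
    · by_cases h1 : d i = (f i).natTrailingDegree + (g i).natTrailingDegree
      · rw [if_pos (Or.inl h1), if_pos h1]; exact h1
      · rw [if_pos (Or.inr h2), if_neg h1]; exact h2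
    · by_cases h1 : d i = (f i).natTrailingDegree + (g i).natTrailingDegree
      · rw [if_pos (Or.inl h1), if_pos h1]; exact h1
      · by_cases h2 : d i = (f i).natTrailingDegree + (g i).natDegree
        · rw [if_pos (Or.inr h2), if_neg h1]; exact h2
        · have hn : ¬ (d i = (f i).natTrailingDegree + (g i).natTrailingDegree ∨
              d i = (f i).natTrailingDegree + (g i).natDegree) := by tauto
          rw [if_neg hn, if_neg h1]; exact h3
  -- the order set and the degree set actually used
  let Z : Finset ℕ := (Finset.univ.image fun i => (f i).natTrailingDegree) ∪
    (Finset.univ.image fun i => (g i).natTrailingDegree)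
  let E : Finset ℕ := (Finset.univ.image fun i => (f i).natDegree) ∪
    (Finset.univ.image fun i => (g i).natDegree)
  have hZ : Z.card ≤ s + 1 := by
    refine le_trans (card_le_of_natTrailingDegree F Z fun n hn => ?_) hFcard
    rcases Finset.mem_union.mp hn with h | h
    · obtain ⟨i, -, rfl⟩ := Finset.mem_image.mp h
      exact ⟨f i, hfF i, hf0 i, rfl⟩
    · obtain ⟨i, -, rfl⟩ := Finset.mem_image.mp h
      exact ⟨g i, hgF i, hg0 i, rfl⟩
  have hE : E.card ≤ s + 1 := by
    refine le_trans (card_le_of_natDegree F E fun n hn => ?_) hFcard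
    rcases Finset.mem_union.mp hn with h | h
    · obtain ⟨i, -, rfl⟩ := Finset.mem_image.mp h
      exact ⟨f i, hfF i, hf0 i, rfl⟩
    · obtain ⟨i, -, rfl⟩ := Finset.mem_image.mp h
      exact ⟨g i, hgF i, hg0 i, rfl⟩
  have haZE : ∀ i, a i ∈ Z ∪ E := by
    intro i
    simp only [a]
    split_ifs
    · exact Finset.mem_union_left _ (Finset.mem_union_left _
        (Finset.mem_image.mpr ⟨i, Finset.mem_univ _, rfl⟩))
    · exact Finset.mem_union_right _ (Finset.mem_union_left _
        (Finset.mem_image.mpr ⟨i, Finset.mem_univ _, rfl⟩))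
  have hbZE : ∀ i, b i ∈ Z ∪ E := by
    intro i
    simp only [b]
    split_ifs
    · exact Finset.mem_union_left _ (Finset.mem_union_right _
        (Finset.mem_image.mpr ⟨i, Finset.mem_univ _, rfl⟩))
    · exact Finset.mem_union_right _ (Finset.mem_union_right _
        (Finset.mem_image.mpr ⟨i, Finset.mem_univ _, rfl⟩))
  let U : Finset ℤ := (Z ∪ E).image (fun n : ℕ => (n : ℤ))
  have hUcard : U.card ≤ 2 * s + 2 := by
    calc U.card ≤ (Z ∪ E).card := Finset.card_image_le
      _ ≤ Z.card + E.card := Finset.card_union_le _ _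
      _ ≤ (s + 1) + (s + 1) := add_le_add hZ hE
      _ = 2 * s + 2 := by ring
  have hU20 : U.card ^ 20 ≤ m ^ 19 :=
    le_trans (Nat.pow_le_pow_left hUcard 20) (pow_twenty_le hs hmC)
  have hcovU : ∀ i, ∃ u ∈ U, ∃ v ∈ U, (d i : ℤ) = u + v := fun i =>
    ⟨(a i : ℤ), Finset.mem_image.mpr ⟨a i, haZE i, rfl⟩, (b i : ℤ),
      Finset.mem_image.mpr ⟨b i, hbZE i, rfl⟩, by rw [hab i]; push_cast; ring⟩
  exact hG m hmG d hinj U hU20 hcovU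

/-- **Reduction of the registered stub `stub_doublyBornTargets` to the TOTALLY-BORN residual.**
The hypothesis is the residual statement: for `m ≥ m₀`, `s^10 ≤ 2^18·m^9`, a quadratic polynomial
swallowing `Γ_i(y) = x^{d_i}` all of whose targets are TOTALLY BORN — `d_i` is NOT of the form
`ord f + ord g`, `ord f + deg g`, `deg f + deg g` for nonzero `f, g ∈ W = span_ℂ(1, y)` — has a relation
of length `≤ 30`.  The conclusion is VERBATIM the registered signature of `stub_doublyBornTargets` of the
line `two_ended_honesty` (with the skeleton's `sourceSpan`, `HonestAtZero`, `HonestAtInfty` unfolded), so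
in the skeleton `stub_doublyBornTargets` closes by `exact stub_doublyBornTargets_of_totallyBorn h`.
Proof: split the doubly-born targets into the cross-honest ones (handled by
`relation_of_orderDegreeCover` with `C = 2^18`) and the totally-born ones (the hypothesis); the larger
class has `m' ≥ m/2` members, so `s^10 ≤ 512 m^9 ≤ 2^18 m'^9`; restrict along `Finset.orderEmbOfFin`
and push the relation forward. [folklore] -/
theorem stub_doublyBornTargets_of_totallyBorn
    (hTB : ∃ m₀ : ℕ, ∀ m ≥ m₀, ∀ (d : Fin m → ℕ) (s : ℕ), s ^ 10 ≤ 262144 * m ^ 9 →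
      ∀ (Γ : Fin m → MvPolynomial (Fin s) ℂ) (y : Fin s → Polynomial ℂ),
        (∀ i, (Γ i).totalDegree ≤ 2) → (∀ i, MvPolynomial.aeval y (Γ i) = Polynomial.X ^ d i) →
        (∀ i, ∀ f ∈ Submodule.span ℂ (insert 1 (Set.range y)),
          ∀ g ∈ Submodule.span ℂ (insert 1 (Set.range y)), f ≠ 0 → g ≠ 0 →
            d i ≠ f.natTrailingDegree + g.natTrailingDegree ∧
            d i ≠ f.natTrailingDegree + g.natDegree ∧
            d i ≠ f.natDegree + g.natDegree) →
        ∃ S T : Multiset (Fin m), S ≠ T ∧ Multiset.card S ≤ 30 ∧ Multiset.card T ≤ 30 ∧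
          (S.map d).sum = (T.map d).sum) :
    ∃ m₀ : ℕ, ∀ m ≥ m₀, ∀ (d : Fin m → ℕ) (s : ℕ), s ^ 10 ≤ 512 * m ^ 9 →
      ∀ (Γ : Fin m → MvPolynomial (Fin s) ℂ) (y : Fin s → Polynomial ℂ),
        (∀ i, (Γ i).totalDegree ≤ 2) → (∀ i, MvPolynomial.aeval y (Γ i) = Polynomial.X ^ d i) →
        (∀ i, ¬ (∃ f ∈ Submodule.span ℂ (insert 1 (Set.range y)),
                  ∃ g ∈ Submodule.span ℂ (insert 1 (Set.range y)), f ≠ 0 ∧ g ≠ 0 ∧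
                    f.natTrailingDegree + g.natTrailingDegree = d i) ∧
              ¬ (∃ f ∈ Submodule.span ℂ (insert 1 (Set.range y)),
                  ∃ g ∈ Submodule.span ℂ (insert 1 (Set.range y)), f ≠ 0 ∧ g ≠ 0 ∧
                    f.natDegree + g.natDegree = d i)) →
        ∃ S T : Multiset (Fin m), S ≠ T ∧ Multiset.card S ≤ 30 ∧ Multiset.card T ≤ 30 ∧
          (S.map d).sum = (T.map d).sum := by
  classical
  obtain ⟨mB, hB⟩ := hTB
  obtain ⟨mC, hC⟩ := relation_of_orderDegreeCover 262144
  refine ⟨2 * (mB + mC), fun m hm d s hs Γ y hΓ hy _hDB => ?_⟩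
  -- the cross-honest (covered) class
  let P : Fin m → Prop := fun i => ∃ f ∈ Submodule.span ℂ (insert 1 (Set.range y)),
    ∃ g ∈ Submodule.span ℂ (insert 1 (Set.range y)), f ≠ 0 ∧ g ≠ 0 ∧
      (d i = f.natTrailingDegree + g.natTrailingDegree ∨
       d i = f.natTrailingDegree + g.natDegree ∨
       d i = f.natDegree + g.natDegree)
  let H : Finset (Fin m) := Finset.univ.filter fun i => P i
  have hcard : H.card + Hᶜ.card = m := by
    rw [Finset.card_compl, Fintype.card_fin]
    have : H.card ≤ m := le_trans (Finset.card_le_univ H) (by simp)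
    omega
  have num : ∀ c : ℕ, m ≤ 2 * c → s ^ 10 ≤ 262144 * c ^ 9 := by
    intro c hc
    calc s ^ 10 ≤ 512 * m ^ 9 := hs
      _ ≤ 512 * (2 * c) ^ 9 := by gcongr
      _ = 262144 * c ^ 9 := by ring
  -- generic restriction-and-pushforward along an order embedding
  have restrict : ∀ (I : Finset (Fin m)),
      (∃ S T : Multiset (Fin I.card), S ≠ T ∧ Multiset.card S ≤ 30 ∧ Multiset.card T ≤ 30 ∧
        (S.map (d ∘ (I.orderEmbOfFin rfl).toEmbedding)).sum =
          (T.map (d ∘ (I.orderEmbOfFin rfl).toEmbedding)).sum) →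
      ∃ S T : Multiset (Fin m), S ≠ T ∧ Multiset.card S ≤ 30 ∧ Multiset.card T ≤ 30 ∧
        (S.map d).sum = (T.map d).sum := by
    intro I h
    obtain ⟨S, T, hne, hS, hT, hsum⟩ := h
    let e : Fin I.card ↪ Fin m := (I.orderEmbOfFin rfl).toEmbedding
    refine ⟨S.map e, T.map e, ?_, by simpa using hS, by simpa using hT, ?_⟩
    · exact fun heq => hne (Multiset.map_injective e.injective heq)
    · simpa [Multiset.map_map, e] using hsum
  by_cases hmaj : m ≤ 2 * H.card
  · -- majority cross-honest: the cover theorem on the restricted family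
    let e : Fin H.card ↪ Fin m := (H.orderEmbOfFin rfl).toEmbedding
    have he : ∀ i, e i ∈ H := fun i => H.orderEmbOfFin_mem rfl i
    refine restrict H (hC H.card (by omega) (d ∘ e) s (num H.card hmaj) y fun i => ?_)
    have hP : P (e i) := (Finset.mem_filter.mp (he i)).2
    exact hP
  · -- majority totally born: the residual hypothesis on the restricted family
    let e : Fin Hᶜ.card ↪ Fin m := (Hᶜ.orderEmbOfFin rfl).toEmbedding
    have he : ∀ i, e i ∈ Hᶜ := fun i => Hᶜ.orderEmbOfFin_mem rfl i
    refine restrict Hᶜ (hB Hᶜ.card (by omega) (d ∘ e) s (num Hᶜ.card (by omega)) (Γ ∘ e) y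
      (fun i => hΓ (e i)) (fun i => hy (e i)) fun i f hf g hg hf0 hg0 => ?_)
    have hnP : ¬ P (e i) := fun hP =>
      (Finset.mem_compl.mp (he i)) (Finset.mem_filter.mpr ⟨Finset.mem_univ _, hP⟩)
    refine ⟨fun h => hnP ⟨f, hf, g, hg, hf0, hg0, Or.inl h⟩,
      fun h => hnP ⟨f, hf, g, hg, hf0, hg0, Or.inr (Or.inl h)⟩,
      fun h => hnP ⟨f, hf, g, hg, hf0, hg0, Or.inr (Or.inr h)⟩⟩

end PolySwallowTotallyBorn

end Summit.ValiantsHypothesis.ValiantsHypothesis.Theorems
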